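import Literature.Computability.Complexity.OracleSubroutine
import Literature.Computability.Complexity.OracleQueryMap
import Literature.Computability.Complexity.TruthTableFunctions
import Literature.Computability.Complexity.PlumbingBricks
import Literature.Computability.Complexity.StringCopy
import Literature.Computability.Complexity.CookReducibilityTransitive
import Literature.Computability.Complexity.CountingHierarchyProofs
import HarnessLib

/-!
# Crux `TransferPB` (stmt-QuantumAdvantage-15238, route SosSandwich), line `birth` — the far-coin machine

Deterministic half of stub `stub_promiseOracleElimination` (`Sig.stub_promiseOracleElimination`,
`Theorems/SosSandwichTransferPBDefs.lean`): PROMISE-`BPP'` ORACLE ELIMINATION relative to a random oracle,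
Bennett–Gill's mechanism "read the coins of the randomised sub-computation off far positions of the oracle"
(Bennett–Gill 1981, Thm. 5; Book–Vollmer–Wagner 1996, §4 Thm. 3; the tree's `BPPSubsetAlmostP.lean` /
`PromiseBPPRelAlmostP.lean` carry it out for whole languages / promise classes — here it is needed INPUT BY
INPUT, for ONE deterministic transcript machine `C` that consults the combined oracle `A ⊕ g`).

* `mem_queries_of_live` — a query asked at a live round of a halting run is a recorded query (so the
  hypothesis "all recorded queries are short" applies to it);
* `tagDec T` — the query decoration `⟨x, ⟨a, u⟩⟩ ↦ ⟨u, 1^{T(|x|)}⟩` (the query `u` of `C` tagged with a unary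
  pad of polynomial length: the pad drives the error exponent of the amplified decider and pushes the coin
  addresses beyond any prescribed length), in `FP`;
* **`exists_simulator`** — for polynomial-time `C` (round/query budget `q`) and ANY polynomial-time
  string-valued subroutine `R` (clock `qR`, query-length bound `sR` against language oracles) ONE
  polynomial-time `C'` and ONE polynomial `q'` such that, for every language oracle `A`, every oracle `O₀`
  that `R` SIMULATES on the short strings (`subAnswer R qR [] A ⟨u, 1^{T n}⟩ = O₀ u` for `|u| ≤ q n`), every
  halting run `C^{O₀}(x) = b` within budget `q` is reproduced: `C'^{A}(x) = b` within `q'(n)` rounds; and ALL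
  queries of `C'` (against every language oracle, halting or not) have length `≤ q'(n)` (the composite of
  `OracleAlg.exists_polyTime_subroutine` with the decorated machine `C.mapQuery (tagDec T)`, capped by
  `capQ`);
* the DISPATCHER run as the subroutine: query generator `dispQ` (on `⟨⟨false :: v, t⟩, 1ⁱ⟩` ask `v`
  itself; on `⟨⟨true :: v, t⟩, 1ⁱ⟩` ask the fresh far address `⟨⟨true :: v, t⟩, 1ⁱ⟩`), evaluator
  `dispD L''` (first branch: the answer bit; second branch: the verdict of the amplified decider `L''` on
  the instance `⟨true :: v, t⟩` with the answer bits as coins; `[]`: reject) and output map `dispG L''`;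
  `dispQ_mem_FP`, `dispD_mem_P`, `dispG_mem_FP`; the values of the truth-table transducer
  `ttFn dispQ k (dispG L'')` on the three kinds of tagged queries (`ttFn_disp_false`, `ttFn_disp_true`,
  `ttFn_disp_nil`) and its query-length bound.

All statements are about the tree's transcript model (`Oracle.lean`, `OracleQueryMap.lean`,
`OracleSubroutine.lean`, `TruthTableFunctions.lean`); nothing open is asserted, no `sorry`.
Sources: C. H. Bennett, J. Gill, SIAM J. Comput. 10 (1981), Thm. 5; R. V. Book, H. Vollmer, K. W. Wagner,
ICALP 1996, §4 Thm. 3; S. Arora, B. Barak, *Computational Complexity* (2009), §3.4, §7.4.1.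
-/

-- D-0017: single-conjunct summit ⇒ the duplicate `QuantumAdvantage.QuantumAdvantage` is mandated.
set_option linter.dupNamespace false

noncomputable section

namespace Summit.QuantumAdvantage.QuantumAdvantage.Cruxes.TransferPB.Birth

open Literature.Computability.Complexity Computability Polynomial PRelSigma OracleCompose TTClosure
open OracleAlg

namespace FarCoin

/-! ### Live queries of a halting run are recorded queries -/

/-- **A query asked at a live round of a halting run is recorded.** If `C` with oracle `O` outputs `b`
within `k` rounds, and at round `i` — all of whose predecessors were queries — `C` asks `u`, then `u` is one
of the recorded queries `C.queries O k x` (the output round comes after every live query round).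
[cite: AroraBarak2009, §3.4] -/
theorem mem_queries_of_live {β : Type} (C : OracleAlg β) (O : Oracle) (x : List Bool) {k : ℕ} {b : β}
    (hrun : C.run O k x = some b) {i : ℕ} {u : List Bool}
    (hpred : ∀ i' < i, ∃ y, C.step x (trans C O x i') = Sum.inl y)
    (hstep : C.step x (trans C O x i) = Sum.inl u) : u ∈ C.queries O k x := by
  obtain ⟨m, hm, -, hout⟩ := (run_eq_some_iff C O k x b).1 hrun
  have him : i < m := by
    by_contra h
    rcases (Nat.not_lt.1 h).eq_or_lt with rfl | hlt
    · rw [hout] at hstep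
      cases hstep
    · obtain ⟨y, hy⟩ := hpred m hlt
      rw [hout] at hy
      cases hy
  have h := mem_queries_of_trans C O k x i (him.trans hm) fun i' hi' => by
    rcases hi'.lt_or_eq with h | rfl
    · exact hpred i' h
    · exact ⟨u, hstep⟩
  rwa [qryOf_eq_of_step_eq hstep] at h

/-! ### The query decoration -/

/-- **The decoration of the queries**: `tagDec T ⟨x, ⟨a, u⟩⟩ = ⟨u, 1^{T(|x|)}⟩` — the query `u` tagged with a
unary pad of length `T(|x|)` (read through `OracleAlg.mapQuery`). [cite: AroraBarak2009, §3.4] -/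
def tagDec (T : Polynomial ℕ) : List Bool → List Bool :=
  pairFn (sndP ∘ sndP) (Plumb.polyFn T ∘ fstP)

/-- Value of `tagDec` on a decorated query. [folklore] -/
theorem tagDec_apply (T : Polynomial ℕ) (x a u : List Bool) :
    tagDec T (boolPair x (boolPair a u)) = boolPair u (ones (T.eval x.length)) := by
  simp [tagDec, Function.comp]

/-- `tagDec T ∈ FP` (pair plumbing and a unary polynomial pad). [cite: AroraBarak2009, Thm. 2.8 (proof: composition)] -/
theorem tagDec_mem_FP (T : Polynomial ℕ) : tagDec T ∈ FP :=
  pairFn_mem_FP (comp_mem_FP sndP_mem_FP sndP_mem_FP) (comp_mem_FP (Plumb.polyFn_mem_FP T) fstP_mem_FP)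

/-! ### The simulator -/

/-- **The far-coin simulator (deterministic part of Bennett–Gill's oracle elimination).** For a
polynomial-time transcript machine `C` with round/query budget `q`, a tag polynomial `T`, and any
polynomial-time string-valued subroutine `R` (clock `qR`; against language oracles all its queries on
input `w` have length `≤ sR(|w|)`), there are ONE polynomial-time `C'` and ONE polynomial `q'` such that
(i) every query of `C'` against every language oracle within `q'(|x|)` rounds has length `≤ q'(|x|)`, and
(ii) for every language `A`, every oracle `O₀` simulated by `R` on the short strings — the clocked run of
`R` with oracle `A` on the tagged query `⟨u, 1^{T(|x|)}⟩` returns `O₀ u` whenever `|u| ≤ q(|x|)` — and every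
run `C^{O₀}(x) = b` within `q(|x|)` rounds whose recorded queries have length `≤ q(|x|)`, the machine `C'`
with oracle `A` outputs `b` within `q'(|x|)` rounds. (`C'` is `OracleAlg.exists_polyTime_subroutine`
applied to `C.mapQuery (tagDec T)` and `R`, capped by `capQ q'`.) [cite: AroraBarak2009, §3.4]
[cite: BennettGill1981, Thm. 5] -/
theorem exists_simulator {C : OracleAlg Bool} (hC : C.IsPolyTime encodingBoolBool) (q T : Polynomial ℕ)
    {R : OracleAlg (List Bool)} (hR : R.IsPolyTime (encodingList Bool)) (qR : Polynomial ℕ)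
    {sR : Polynomial ℕ}
    (hsR : ∀ (A : Language Bool) (w : List Bool) (k : ℕ),
      ∀ y ∈ R.queries (Oracle.ofLanguage A) k w, y.length ≤ sR.eval w.length) :
    ∃ (C' : OracleAlg Bool) (q' : Polynomial ℕ), C'.IsPolyTime encodingBoolBool ∧
      (∀ (A : Language Bool) (x : List Bool),
        ∀ y ∈ C'.queries (Oracle.ofLanguage A) (q'.eval x.length) x, y.length ≤ q'.eval x.length) ∧
      ∀ (A : Language Bool) (O₀ : Oracle) (x : List Bool) (b : Bool),
        (∀ u : List Bool, u.length ≤ q.eval x.length →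
          subAnswer R qR [] (Oracle.ofLanguage A) (boolPair u (ones (T.eval x.length))) = O₀ u) →
        C.run O₀ (q.eval x.length) x = some b →
        (∀ y ∈ C.queries O₀ (q.eval x.length) x, y.length ≤ q.eval x.length) →
        C'.run (Oracle.ofLanguage A) (q'.eval x.length) x = some b := by
  -- the decorated machine and its budget
  set qM : Polynomial ℕ := 2 * q + 2 + T with hqM
  have hqM_eval : ∀ n, qM.eval n = 2 * q.eval n + 2 + T.eval n := fun n => by simp [hqM]
  have hM : (C.mapQuery (tagDec T)).IsPolyTime encodingBoolBool := isPolyTime_mapQuery _ hC (tagDec_mem_FP T)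
  obtain ⟨C₁, hC₁, qC, hspec⟩ := exists_polyTime_subroutine hM hR qM qR []
  set q' : Polynomial ℕ := qC + sR.comp qM with hq'
  have hq'_eval : ∀ n, q'.eval n = qC.eval n + sR.eval (qM.eval n) := fun n => by simp [hq', eval_comp]
  refine ⟨C₁.capQ q' false, q', isPolyTime_capQ _ hC₁ q' false,
    fun A x y hy => length_le_of_mem_queries_capQ C₁ q' false _ x _ hy, ?_⟩
  intro A O₀ x b hsim hrun hqC
  set Osub : Oracle := subAnswer R qR [] (Oracle.ofLanguage A) with hOsub
  -- along the run of `C` with `O₀`, the subroutine answers the tagged query as `O₀` answers the query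
  have hagree : MapAgree C (tagDec T) Osub O₀ x := by
    intro i u hpred hstep
    have hu : u.length ≤ q.eval x.length := hqC u (mem_queries_of_live C O₀ x hrun hpred hstep)
    rw [tagDec_apply]
    exact hsim u hu
  have hle : q.eval x.length ≤ qM.eval x.length := by rw [hqM_eval]; omega
  have hMrun : (C.mapQuery (tagDec T)).run Osub (qM.eval x.length) x = some b := by
    refine run_mono _ _ _ hle ?_
    rw [run_mapQuery C (tagDec T) Osub O₀ x hagree]
    exact hrun
  have hMq : ∀ y ∈ (C.mapQuery (tagDec T)).queries Osub (qM.eval x.length) x, y.length ≤ qM.eval x.length := by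
    intro y hy
    obtain ⟨i, u, hpred, hstep, -, rfl⟩ := queries_mapQuery C (tagDec T) Osub O₀ x hagree _ hy
    have hu : u.length ≤ q.eval x.length := hqC u (mem_queries_of_live C O₀ x hrun hpred hstep)
    have hlo : (ones (T.eval x.length)).length = T.eval x.length := by simp [ones]
    rw [tagDec_apply, length_boolPair, hlo, hqM_eval]
    omega
  obtain ⟨hC₁run, hC₁q⟩ := hspec (Oracle.ofLanguage A) x b hMrun hMq
  -- the queries of the composite are queries of clocked runs of `R` on tagged short queries
  have hbound : ∀ y ∈ C₁.queries (Oracle.ofLanguage A) (qC.eval x.length) x, y.length ≤ q'.eval x.length := by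
    intro y hy
    rw [hC₁q] at hy
    obtain ⟨w, hw, hy'⟩ := List.mem_flatMap.1 hy
    have hyR := queries_clock_subset R qR [] _ w _ hy'
    have h1 : y.length ≤ sR.eval w.length := hsR A w _ y hyR
    have h2 : sR.eval w.length ≤ sR.eval (qM.eval x.length) := TM2Iter.eval_mono sR (hMq w hw)
    rw [hq'_eval]
    omega
  have hcap := (run_capQ C₁ q' false (Oracle.ofLanguage A) x (qC.eval x.length) hbound).1
  have hle' : qC.eval x.length ≤ q'.eval x.length := by rw [hq'_eval]; omega
  refine run_mono _ _ _ hle' ?_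
  rw [hcap]
  exact hC₁run

/-! ### The dispatcher -/

/-- The guard "the tagged query starts with `false`": `⟨⟨u, t⟩, s⟩` with `u = false :: v`. [folklore] -/
def SelF : Language Bool := (fstP ∘ fstP) ⁻¹' HeadIs false

/-- The guard "the tagged query starts with `true`": `⟨⟨u, t⟩, s⟩` with `u = true :: v`. [folklore] -/
def SelT : Language Bool := (fstP ∘ fstP) ⁻¹' HeadIs true

/-- Membership in `SelF`. [folklore] -/
theorem mem_SelF_iff (u t s : List Bool) : boolPair (boolPair u t) s ∈ SelF ↔ u.head? = some false := by
  simp [SelF, memL_preimage, Function.comp]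

/-- Membership in `SelT`. [folklore] -/
theorem mem_SelT_iff (u t s : List Bool) : boolPair (boolPair u t) s ∈ SelT ↔ u.head? = some true := by
  simp [SelT, memL_preimage, Function.comp]

/-- `SelF ∈ P`. [folklore] -/
theorem SelF_mem_P : SelF ∈ Classes.P := preimage_mem_P (HeadIs_mem_P false) (comp_mem_FP fstP_mem_FP fstP_mem_FP)

/-- `SelT ∈ P`. [folklore] -/
theorem SelT_mem_P : SelT ∈ Classes.P := preimage_mem_P (HeadIs_mem_P true) (comp_mem_FP fstP_mem_FP fstP_mem_FP)

/-- **The query generator of the dispatcher**: on `w = ⟨⟨false :: v, t⟩, 1ⁱ⟩` the query is `v` (a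
membership question about the random oracle itself); otherwise the query is `w` (a fresh, long address
whose oracle bit serves as the `i`-th coin). [cite: BennettGill1981, Thm. 5 (coins read off the oracle)] -/
def dispQ : List Bool → List Bool := condFn SelF (List.tail ∘ fstP ∘ fstP) id

/-- `dispQ ∈ FP`. [folklore] -/
theorem dispQ_mem_FP : dispQ ∈ FP :=
  condFn_mem_FP SelF_mem_P (comp_mem_FP tail_mem_FP (comp_mem_FP fstP_mem_FP fstP_mem_FP)) id_mem_FP

/-- `dispQ` on a `false`-query: ask `v`. [folklore] -/
theorem dispQ_false (v t s : List Bool) : dispQ (boolPair (boolPair (false :: v) t) s) = v := by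
  rw [dispQ, condFn_of_mem _ _ ((mem_SelF_iff _ _ _).2 rfl)]
  simp [Function.comp]

/-- `dispQ` on a `true`-query: ask the address itself. [folklore] -/
theorem dispQ_true (v t s : List Bool) :
    dispQ (boolPair (boolPair (true :: v) t) s) = boolPair (boolPair (true :: v) t) s := by
  rw [dispQ, condFn_of_not_mem _ _ (fun h => by simpa using (mem_SelF_iff _ _ _).1 h)]
  rfl

/-- `dispQ` on the empty query: ask the address itself. [folklore] -/
theorem dispQ_nil (t s : List Bool) : dispQ (boolPair (boolPair [] t) s) = boolPair (boolPair [] t) s := by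
  rw [dispQ, condFn_of_not_mem _ _ (fun h => by simpa using (mem_SelF_iff _ _ _).1 h)]
  rfl

/-- **The evaluator of the dispatcher** on `⟨⟨u, t⟩, bits⟩`: for `u = false :: v` accept iff some answer
bit is `true` (all answer bits are the bit `[v ∈ A]`); for `u = true :: v` accept iff `⟨⟨u, t⟩, bits⟩ ∈ L''`
(the amplified decider on the instance `⟨u, t⟩` with coins `bits`); reject `u = []`.
[cite: BennettGill1981, Thm. 5] -/
def dispD (L'' : Language Bool) : Language Bool := (SelF ⊓ (sndP ⁻¹' HasBit true)) ⊔ (SelT ⊓ L'')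

/-- `dispD L'' ∈ P` for `L'' ∈ P`. [folklore] -/
theorem dispD_mem_P {L'' : Language Bool} (hL'' : L'' ∈ Classes.P) : dispD L'' ∈ Classes.P :=
  union_mem_P (inter_mem_P SelF_mem_P (preimage_mem_P (HasBit_mem_P true) sndP_mem_FP))
    (inter_mem_P SelT_mem_P hL'')

/-- `dispD` on a `false`-query. [folklore] -/
theorem mem_dispD_false (L'' : Language Bool) (v t bits : List Bool) :
    boolPair (boolPair (false :: v) t) bits ∈ dispD L'' ↔ true ∈ bits := by
  have h1 : boolPair (boolPair (false :: v) t) bits ∈ SelF := (mem_SelF_iff _ _ _).2 rfl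
  have h2 : boolPair (boolPair (false :: v) t) bits ∉ SelT := fun h => by simpa using (mem_SelT_iff _ _ _).1 h
  change (_ ∈ SelF ∧ sndP _ ∈ HasBit true) ∨ (_ ∈ SelT ∧ _ ∈ L'') ↔ _
  simp [h1, h2]

/-- `dispD` on a `true`-query. [folklore] -/
theorem mem_dispD_true (L'' : Language Bool) (v t bits : List Bool) :
    boolPair (boolPair (true :: v) t) bits ∈ dispD L'' ↔ boolPair (boolPair (true :: v) t) bits ∈ L'' := by
  have h1 : boolPair (boolPair (true :: v) t) bits ∉ SelF := fun h => by simpa using (mem_SelF_iff _ _ _).1 h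
  have h2 : boolPair (boolPair (true :: v) t) bits ∈ SelT := (mem_SelT_iff _ _ _).2 rfl
  change (_ ∈ SelF ∧ sndP _ ∈ HasBit true) ∨ (_ ∈ SelT ∧ _ ∈ L'') ↔ _
  simp [h1, h2]

/-- `dispD` on the empty query: reject. [folklore] -/
theorem not_mem_dispD_nil (L'' : Language Bool) (t bits : List Bool) :
    boolPair (boolPair [] t) bits ∉ dispD L'' := by
  have h1 : boolPair (boolPair [] t) bits ∉ SelF := fun h => by simpa using (mem_SelF_iff _ _ _).1 h
  have h2 : boolPair (boolPair [] t) bits ∉ SelT := fun h => by simpa using (mem_SelT_iff _ _ _).1 h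
  change ¬ ((_ ∈ SelF ∧ sndP _ ∈ HasBit true) ∨ (_ ∈ SelT ∧ _ ∈ L''))
  simp [h1, h2]

/-- **The output map of the dispatcher**: the indicator bit of `dispD L''`, as a one-bit string (the format
of a language oracle's answer). [folklore] -/
def dispG (L'' : Language Bool) : List Bool → List Bool := fun w => encodeBool ((dispD L'').boolIndicator w)

/-- `dispG L'' ∈ FP` for `L'' ∈ P`. [folklore] -/
theorem dispG_mem_FP {L'' : Language Bool} (hL'' : L'' ∈ Classes.P) : dispG L'' ∈ FP :=
  indicatorFn_mem_FP (dispD_mem_P hL'')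

/-- `dispG` is the language oracle of `dispD`. [folklore] -/
theorem dispG_apply (L'' : Language Bool) (w : List Bool) : dispG L'' w = Oracle.ofLanguage (dispD L'') w := rfl

/-! ### The dispatcher as a truth-table transducer: its values on tagged queries -/

/-- On a `true`-query the dispatcher's answer bits are the oracle's bits at the fresh addresses
`⟨x', 1ⁱ⟩`: `ttBits dispQ A x' m = ttBits id A x' m`. [folklore] -/
theorem ttBits_disp_true (A : Language Bool) (v t : List Bool) (m : ℕ) :
    ttBits dispQ A (boolPair (true :: v) t) m = ttBits id A (boolPair (true :: v) t) m := by
  simp [ttBits, dispQ_true]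

/-- On a `false`-query every answer bit is the bit `[v ∈ A]`. [folklore] -/
theorem ttBits_disp_false (A : Language Bool) (v t : List Bool) (m : ℕ) :
    ttBits dispQ A (boolPair (false :: v) t) m = List.replicate m (A.boolIndicator v) := by
  simp [ttBits, dispQ_false, List.map_const', List.length_range]

/-- **The dispatcher on a `false`-query returns the membership bit** `[v ∈ A]` (as the one-bit string of a
language oracle), provided it asks at least one query. [cite: BennettGill1981, Thm. 5] -/
theorem ttFn_disp_false {L'' : Language Bool} {k : Polynomial ℕ} (A : Language Bool) (v t : List Bool)
    (hk : 1 ≤ k.eval (boolPair (false :: v) t).length) :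
    ttFn dispQ k (dispG L'') A (boolPair (false :: v) t) = Oracle.ofLanguage A v := by
  rw [ttFn_apply, dispG_apply, Oracle.ofLanguage_apply, Oracle.ofLanguage_apply, ttBits_disp_false]
  congr 1
  rw [Bool.eq_iff_iff]
  constructor
  · intro h
    have h' := (mem_dispD_false L'' v t _).1 ((Set.mem_iff_boolIndicator _ _).2 h)
    rw [List.mem_replicate] at h'
    exact h'.2.symm
  · intro h
    apply (Set.mem_iff_boolIndicator _ _).1
    exact (mem_dispD_false L'' v t _).2 (List.mem_replicate.2 ⟨by omega, h.symm⟩)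

/-- **The dispatcher on a `true`-query returns the verdict of `L''`** on the instance `x' = ⟨true :: v, t⟩`
with the oracle's bits at the fresh addresses `⟨x', 1ⁱ⟩`, `i < k(|x'|)`, as coins.
[cite: BennettGill1981, Thm. 5] -/
theorem ttFn_disp_true {L'' : Language Bool} {k : Polynomial ℕ} (A : Language Bool) (v t : List Bool) :
    ttFn dispQ k (dispG L'') A (boolPair (true :: v) t) =
      encodeBool (L''.boolIndicator (boolPair (boolPair (true :: v) t)
        (ttBits id A (boolPair (true :: v) t) (k.eval (boolPair (true :: v) t).length)))) := by
  rw [ttFn_apply, dispG_apply, Oracle.ofLanguage_apply, ttBits_disp_true]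
  congr 1
  rw [Bool.eq_iff_iff]
  constructor
  · intro h
    exact (Set.mem_iff_boolIndicator _ _).1 ((mem_dispD_true L'' _ _ _).1 ((Set.mem_iff_boolIndicator _ _).2 h))
  · intro h
    exact (Set.mem_iff_boolIndicator _ _).1 ((mem_dispD_true L'' _ _ _).2 ((Set.mem_iff_boolIndicator _ _).2 h))

/-- **The dispatcher on the empty query rejects.** [folklore] -/
theorem ttFn_disp_nil {L'' : Language Bool} {k : Polynomial ℕ} (A : Language Bool) (t : List Bool) :
    ttFn dispQ k (dispG L'') A (boolPair [] t) = [false] := by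
  rw [ttFn_apply, dispG_apply, Oracle.ofLanguage_apply,
    (Set.notMem_iff_boolIndicator _ _).1 (not_mem_dispD_nil L'' t _)]
  rfl

/-- **The clocked dispatcher computes `ttFn`**: with the clock `k + 1` the subroutine answer on `x'` is
`ttFn dispQ k (dispG L'') A x'` (`run_ttFnAlg`). [cite: LadnerLynchSelman1975, §3] -/
theorem subAnswer_disp (L'' : Language Bool) (k : Polynomial ℕ) (A : Language Bool) (x' : List Bool) :
    subAnswer (ttFnAlg dispQ k (dispG L'')) (k + 1) [] (Oracle.ofLanguage A) x' =
      ttFn dispQ k (dispG L'') A x' :=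
  subAnswer_of_run_eq_some _ _ _ _ (run_ttFnAlg A x' (by simp))

/-- **Query-length bound of the dispatcher** against language oracles: every query on input `w` has length
`≤ sQ(2|w| + 2 + k(|w|))` for an output-length bound `sQ` of `dispQ`. [folklore] -/
theorem exists_queryBound_disp (L'' : Language Bool) (k : Polynomial ℕ) :
    ∃ sR : Polynomial ℕ, ∀ (A : Language Bool) (w : List Bool) (m : ℕ),
      ∀ y ∈ (ttFnAlg dispQ k (dispG L'')).queries (Oracle.ofLanguage A) m w, y.length ≤ sR.eval w.length := by
  obtain ⟨s, hs⟩ := exists_poly_length_le_of_mem_FP dispQ_mem_FP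
  refine ⟨s.comp (2 * X + 2 + k), fun A w m y hy => ?_⟩
  obtain ⟨i, hi, rfl⟩ := exists_of_mem_queries_ttFnAlg A w hy
  refine (hs _).trans ?_
  rw [eval_comp]
  refine TM2Iter.eval_mono s ?_
  simp only [length_boolPair, List.length_replicate, eval_add, eval_mul, eval_ofNat, eval_X]
  omega

end FarCoin

end Summit.QuantumAdvantage.QuantumAdvantage.Cruxes.TransferPB.Birth

end
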